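import Literature.NumberTheory.EllipticCurves.VariableChangeApproxProofs
import Mathlib.AlgebraicGeometry.EllipticCurve.VariableChange
import HarnessLib

/-!
# The residue of the discriminant unit at a wild Kodaira type IV / II* over a place with
# uniformiser `3`: `δ = −8β₄³ − π·β₆² + π²·t` (THE BRACKET LEMMA for the wild `f = 4` rows; cell
# `b2b-bsdres`, seat `b2b-bsdres-x11b3-p7` GEN 7 as cross-cell pool hand; theorems only, no curve over
# `ℚ` is mentioned — generic Dedekind domain `A`, place `v`, completion `K_v`)

HONEST FRAMING (cell `b2b-bsdres`, run/shared/lean/b2b/bsd-rank1-residual/, verbatim in every file): the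
goal of the cell is to DELETE the COMBINATION-SHAPED residual classes of the Birch–Swinnerton-Dyer formula
for ALL analytic-rank `≤ 1` elliptic curves over `ℚ` — assembled STRICTLY from published theorems — so that
the rank-`≤ 1` remainder becomes exactly the CONSTRUCTION-SHAPED classes, which are TYPED, NOT attempted.
This is not "finishing BSD". Lane CLASS-CLOSURE / team o6 (O6 OPEN); nothing booked; no mark of
`RESIDUAL-MAP.md` moves. This file: ONE public theorem of pure valuation algebra (no definition, no named
fact, no `sorry`), consumed by `Additive/CondExpFourUnitPartLawThreeHolds.lean` (L-O6-cyc9 unconditional).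

## What is proved

**`valued_δ_residue_of_wild_shape`**: on a Weierstrass equation over the completion `K_v` whose
`b₂ = π^{k₂}β₂`, `b₄ = π^{k₄}β₄`, `b₆ = π^{k₆}β₆`, `Δ = π^e δ` with `βᵢ ∈ 𝒪_v`, `β₆, δ ∈ 𝒪_v^×`,
`(π : K_v) = 3` a uniformiser, and `(k₂,k₄,k₆;e) = (1,2,2;6)` (the Kodaira-IV normal form of
Silverman *ATAEC* IV.9.4 Step 5 with `f = 4`, i.e. the Halberstadt–Rizzo row `(3,5,6)`) or `(2,4,5;12)`
(the II* normal form of Step 10 with `f = 4`, row `(5,8,12)`): **`v(β₄) = 1` and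
`δ = −8β₄³ − π·β₆² + π²·t` for some `t ∈ 𝒪_v`.** Proof: the identity
`4Δ = −b₂²(b₂b₆ − b₄²) − 32b₄³ − 4·27·b₆² + 4·9·b₂b₄b₆` (Mathlib `b_relation`) with `27 = π³`, `9 = π²`
reads `4π^{e}δ = −π^{e−1}β₂³β₆ + π^{e}(β₂²β₄² − 32β₄³) + π^{e+1}(−4β₆² + 4β₂β₄β₆)`; if `β₂` were a unit
the right side would have `ord = e − 1` — so `β₂ = πγ`, and dividing by `4π^e` (`2` is a unit: `3` is
not) gives the displayed residue; `δ` a unit then forces `β₄` a unit. These are the shapes delivered by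
the tree's `WeierstrassCurve.exists_variableChange_b_of_kodairaSymbolAt_wild`
(`OggFormulaWildTypesKodairaProofs`, bsd.S15). Census reading (EVIDENCE only, o6-r1 GEN 3): on the
1 833 `f₃ = 4`, `v₃Δ ∈ {6,12}` rows `Δ′ ≡ 5, 7 (mod 9)`, which is `−8·(±1) − 3`.

References: J. H. Silverman, *Advanced Topics in the Arithmetic of Elliptic Curves*, GTM 151 (1994),
IV.9.4 Steps 5 and 10, III.1 [SilvermanATAEC1994]; A. Kraus, Manuscripta Math. 69 (1990) 353–385.
-/

noncomputable section

open scoped Classical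

open WeierstrassCurve IsDedekindDomain IsDedekindDomain.HeightOneSpectrum WithZero

namespace Summit.BirchSwinnertonDyer.Rank1Residual.Additive

/-! ## §1 Local algebra on a `K_v`-model with the IV / II* shapes: `δ ≡ −8β₄³ − πβ₆² (mod π²)` -/

section Local

variable {A : Type*} [CommRing A] [IsDedekindDomain A] {K : Type*} [Field K] [Algebra A K]
  [IsFractionRing A K] (v : HeightOneSpectrum A)

/-- In `ℤᵐ⁰`: strictly below `1 = exp 0` means at most `exp (−1)`. [folklore] -/
private theorem le_exp_neg_one_of_lt_one' {x : ℤᵐ⁰} (hx : x < 1) : x ≤ exp (-1 : ℤ) := by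
  rcases eq_or_ne x 0 with rfl | h0
  · simp
  · rw [← exp_log h0, ← exp_zero, exp_lt_exp] at hx
    rw [← exp_log h0, exp_le_exp]; omega

/-- **The residue lemma for the wild types IV and II* at a place with uniformiser `π = 3`.** On a
`K_v`-model with `b₂ = π^{k₂}β₂`, `b₄ = π^{k₄}β₄`, `b₆ = π^{k₆}β₆`, `Δ = π^e δ` (`βᵢ ∈ 𝒪_v`, `β₆` and
`δ` units) and `(k₂,k₄,k₆;e) = (1,2,2;6)` (Kodaira IV with `f = 4`) or `(2,4,5;12)` (II*): from
`4Δ = −b₂²(b₂b₆ − b₄²) − 32b₄³ − 4·27·b₆² + 4·9·b₂b₄b₆` one gets `β₂ ∈ π𝒪_v` (else `ord Δ = e − 1`),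
then `β₄ ∈ 𝒪_v^×` and **`δ = −8β₄³ − π·β₆² + π²·t`** with `t ∈ 𝒪_v`.
[cite: SilvermanATAEC1994, IV.9.4 Steps 5 and 10 (normal forms of IV, II*), III.1 (b-invariants, Δ)] -/
theorem valued_δ_residue_of_wild_shape {π : K} (hπ : v.valuation K π = exp (-1 : ℤ))
    (h3 : (π : v.adicCompletion K) = 3) (N : WeierstrassCurve (v.adicCompletion K))
    {k₂ k₄ k₆ e : ℕ} (β₂ β₄ β₆ δ : v.adicCompletionIntegers K) (hβ₆ : IsUnit β₆) (hδ : IsUnit δ)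
    (hb₂ : N.b₂ = (π : v.adicCompletion K) ^ k₂ * β₂)
    (hb₄ : N.b₄ = (π : v.adicCompletion K) ^ k₄ * β₄)
    (hb₆ : N.b₆ = (π : v.adicCompletion K) ^ k₆ * β₆)
    (hΔ : N.Δ = (π : v.adicCompletion K) ^ e * δ)
    (hk : (k₂ = 1 ∧ k₄ = 2 ∧ k₆ = 2 ∧ e = 6) ∨ (k₂ = 2 ∧ k₄ = 4 ∧ k₆ = 5 ∧ e = 12)) :
    Valued.v (β₄ : v.adicCompletion K) = 1 ∧
      ∃ t : v.adicCompletion K, Valued.v t ≤ 1 ∧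
        (δ : v.adicCompletion K) = -8 * (β₄ : v.adicCompletion K) ^ 3 -
          (π : v.adicCompletion K) * (β₆ : v.adicCompletion K) ^ 2 +
          (π : v.adicCompletion K) ^ 2 * t := by
  set w : Valuation (v.adicCompletion K) ℤᵐ⁰ := Valued.v with hw
  set ϖ : v.adicCompletion K := (π : v.adicCompletion K) with hϖ
  have hπv : w ϖ = exp (-1 : ℤ) := by rw [hw, hϖ, valuedAdicCompletion_eq_valuation', hπ]
  have hϖ0 : ϖ ≠ 0 := fun h ↦ by rw [h, map_zero] at hπv; exact (exp_ne_zero).symm hπv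
  have hint : ∀ β : v.adicCompletionIntegers K, w (β : v.adicCompletion K) ≤ 1 := fun β ↦ β.2
  have hnat : ∀ n : ℕ, w (n : v.adicCompletion K) ≤ 1 := fun n ↦ by
    rw [← map_natCast (algebraMap K (v.adicCompletion K)) n]
    have : w (algebraMap K (v.adicCompletion K) n) = v.valuation K n :=
      valuedAdicCompletion_eq_valuation' v (n : K)
    rw [this, ← map_natCast (algebraMap A K) n]
    exact v.valuation_le_one _
  have hunit : ∀ {β : v.adicCompletionIntegers K}, IsUnit β → w (β : v.adicCompletion K) = 1 := by
    intro β hβ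
    obtain ⟨γ, hγ⟩ := hβ.exists_right_inv
    have h1 : w (β : v.adicCompletion K) * w (γ : v.adicCompletion K) = 1 := by
      rw [← map_mul, ← Subring.coe_mul, hγ]; simp
    refine le_antisymm (hint β) ?_
    calc (1 : ℤᵐ⁰) = w (β : v.adicCompletion K) * w (γ : v.adicCompletion K) := h1.symm
      _ ≤ w (β : v.adicCompletion K) * 1 := mul_le_mul' le_rfl (hint γ)
      _ = _ := mul_one _
  -- `2` and `4` are units at `v` (residue characteristic `3`: `w(3) < 1`)
  have h2 : w (2 : v.adicCompletion K) = 1 := by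
    refine le_antisymm (by exact_mod_cast hnat 2) ?_
    by_contra hlt
    push Not at hlt
    have h3lt : w (3 : v.adicCompletion K) < 1 := by
      rw [← h3, hπv, ← exp_zero, exp_lt_exp]; norm_num
    have : w ((3 : v.adicCompletion K) - 2) < 1 :=
      lt_of_le_of_lt (w.map_sub _ _) (max_lt h3lt hlt)
    norm_num at this
  have h4 : w (4 : v.adicCompletion K) = 1 := by
    rw [show (4 : v.adicCompletion K) = 2 * 2 by norm_num, map_mul, h2, mul_one]
  have h40 : (4 : v.adicCompletion K) ≠ 0 := fun h ↦ by rw [h, map_zero] at h4; exact zero_ne_one h4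
  -- the `4Δ` identity on the model
  have hrel := N.b_relation
  have hid : 4 * N.Δ = -(N.b₂ ^ 2 * (N.b₂ * N.b₆ - N.b₄ ^ 2)) - 32 * N.b₄ ^ 3
      - 4 * 3 ^ 3 * N.b₆ ^ 2 + 4 * 3 ^ 2 * (N.b₂ * N.b₄ * N.b₆) := by
    simp only [WeierstrassCurve.Δ]
    linear_combination (-(N.b₂ ^ 2)) * hrel
  -- substitute the shapes; `d + 1 = e`
  obtain ⟨d, hd, hshape⟩ : ∃ d : ℕ, d + 1 = e ∧
      4 * ϖ ^ (d + 1) * (δ : v.adicCompletion K) =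
        -(ϖ ^ d * ((β₂ : v.adicCompletion K) ^ 3 * β₆)) +
          ϖ ^ (d + 1) * ((β₂ : v.adicCompletion K) ^ 2 * β₄ ^ 2 - 32 * β₄ ^ 3) +
          ϖ ^ (d + 2) * (-4 * (β₆ : v.adicCompletion K) ^ 2 + 4 * β₂ * β₄ * β₆) := by
    rw [← h3] at hid
    rcases hk with ⟨rfl, rfl, rfl, rfl⟩ | ⟨rfl, rfl, rfl, rfl⟩
    · refine ⟨5, rfl, ?_⟩
      rw [hb₂, hb₄, hb₆, hΔ] at hid
      linear_combination hid
    · refine ⟨11, rfl, ?_⟩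
      rw [hb₂, hb₄, hb₆, hΔ] at hid
      linear_combination hid
  have hdT : ∀ (k : ℕ) (x : v.adicCompletion K), w x ≤ 1 → w (ϖ ^ k * x) ≤ exp (-(k : ℤ)) := by
    intro k x hx
    rw [map_mul, map_pow, hπv, ← exp_nsmul]
    calc exp (k • (-1 : ℤ)) * w x ≤ exp (k • (-1 : ℤ)) * 1 := mul_le_mul' le_rfl hx
      _ = exp (-(k : ℤ)) := by simp
  -- integrality of the three brackets
  have hB1 : w ((β₂ : v.adicCompletion K) ^ 3 * β₆) ≤ 1 := by
    rw [map_mul, map_pow]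
    exact mul_le_one' (pow_le_one' (hint β₂) 3) (hint β₆)
  have hB2 : w ((β₂ : v.adicCompletion K) ^ 2 * β₄ ^ 2 - 32 * β₄ ^ 3) ≤ 1 := by
    refine w.map_sub_le ?_ ?_
    · rw [map_mul, map_pow, map_pow]
      exact mul_le_one' (pow_le_one' (hint β₂) 2) (pow_le_one' (hint β₄) 2)
    · rw [map_mul, map_pow]
      exact mul_le_one' (by exact_mod_cast hnat 32) (pow_le_one' (hint β₄) 3)
  have hB3 : w (-4 * (β₆ : v.adicCompletion K) ^ 2 + 4 * β₂ * β₄ * β₆) ≤ 1 := by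
    refine w.map_add_le ?_ ?_
    · rw [map_mul, Valuation.map_neg, map_pow]
      exact mul_le_one' (by exact_mod_cast hnat 4) (pow_le_one' (hint β₆) 2)
    · rw [map_mul, map_mul, map_mul]
      exact mul_le_one' (mul_le_one' (mul_le_one' (by exact_mod_cast hnat 4) (hint β₂)) (hint β₄))
        (hint β₆)
  -- Step A: `β₂` is not a unit (else `ord Δ = e - 1`)
  have hβ₂ : w (β₂ : v.adicCompletion K) < 1 := by
    refine lt_of_le_of_ne (hint β₂) fun hβ ↦ ?_
    have hT1 : w (-(ϖ ^ d * ((β₂ : v.adicCompletion K) ^ 3 * β₆))) = exp (-(d : ℤ)) := by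
      rw [Valuation.map_neg, map_mul, map_pow, hπv, map_mul, map_pow, hβ, hunit hβ₆, one_pow, one_mul,
        mul_one, ← exp_nsmul]; simp
    have hT23 : w (ϖ ^ (d + 1) * ((β₂ : v.adicCompletion K) ^ 2 * β₄ ^ 2 - 32 * β₄ ^ 3) +
        ϖ ^ (d + 2) * (-4 * (β₆ : v.adicCompletion K) ^ 2 + 4 * β₂ * β₄ * β₆)) < exp (-(d : ℤ)) := by
      refine lt_of_le_of_lt (w.map_add_le (hdT (d + 1) _ hB2) ((hdT (d + 2) _ hB3).trans ?_)) ?_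
      · exact exp_le_exp.mpr (by push_cast; omega)
      · exact exp_lt_exp.mpr (by push_cast; omega)
    have hR : w (-(ϖ ^ d * ((β₂ : v.adicCompletion K) ^ 3 * β₆)) +
        (ϖ ^ (d + 1) * ((β₂ : v.adicCompletion K) ^ 2 * β₄ ^ 2 - 32 * β₄ ^ 3) +
          ϖ ^ (d + 2) * (-4 * (β₆ : v.adicCompletion K) ^ 2 + 4 * β₂ * β₄ * β₆))) = exp (-(d : ℤ)) := by
      rw [w.map_add_eq_of_lt_left (by rw [hT1]; exact hT23), hT1]
    have hL : w (4 * ϖ ^ (d + 1) * (δ : v.adicCompletion K)) = exp (-((d + 1 : ℕ) : ℤ)) := by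
      rw [map_mul, map_mul, h4, one_mul, map_pow, hπv, hunit hδ, mul_one, ← exp_nsmul]; simp
    rw [hshape, add_assoc] at hL
    rw [hL] at hR
    have := exp_injective hR
    push_cast at this
    omega
  -- Step B: `β₂ = ϖ γ` with `γ` integral
  set γ : v.adicCompletion K := (β₂ : v.adicCompletion K) / ϖ with hγ
  have hγw : w γ ≤ 1 := by
    rw [hγ, map_div₀, hπv]
    rcases eq_or_ne (w (β₂ : v.adicCompletion K)) 0 with h0 | h0
    · rw [h0, zero_div]; simp
    · have hle := le_exp_neg_one_of_lt_one' hβ₂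
      rw [← exp_log h0] at hle ⊢
      rw [exp_le_exp] at hle
      rw [div_eq_mul_inv, ← exp_neg, ← exp_add, ← exp_zero, exp_le_exp]; omega
  have hβγ : (β₂ : v.adicCompletion K) = ϖ * γ := by rw [hγ, mul_div_cancel₀ _ hϖ0]
  -- Step C: divide by `ϖ^{d+1}` and by `4`
  set t : v.adicCompletion K :=
    (-γ ^ 3 * (β₆ : v.adicCompletion K) + γ ^ 2 * β₄ ^ 2 + 4 * γ * β₄ * β₆) / 4 with ht
  have htw : w t ≤ 1 := by
    rw [ht, map_div₀, h4, div_one]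
    refine w.map_add_le (w.map_add_le ?_ ?_) ?_
    · rw [map_mul, Valuation.map_neg, map_pow]
      exact mul_le_one' (pow_le_one' hγw 3) (hint β₆)
    · rw [map_mul, map_pow, map_pow]
      exact mul_le_one' (pow_le_one' hγw 2) (pow_le_one' (hint β₄) 2)
    · rw [map_mul, map_mul, map_mul, h4, one_mul]
      exact mul_le_one' (mul_le_one' hγw (hint β₄)) (hint β₆)
  have hδeq : (δ : v.adicCompletion K) = -8 * (β₄ : v.adicCompletion K) ^ 3 -
      ϖ * (β₆ : v.adicCompletion K) ^ 2 + ϖ ^ 2 * t := by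
    have hpow : ϖ ^ (d + 1) ≠ 0 := pow_ne_zero _ hϖ0
    have key : ϖ ^ (d + 1) * (4 * (δ : v.adicCompletion K)) =
        ϖ ^ (d + 1) * (-ϖ ^ 2 * γ ^ 3 * β₆ + ϖ ^ 2 * γ ^ 2 * β₄ ^ 2 - 32 * β₄ ^ 3 -
          4 * ϖ * β₆ ^ 2 + 4 * ϖ ^ 2 * γ * β₄ * β₆) := by
      rw [hβγ] at hshape
      linear_combination hshape
    have key' := mul_left_cancel₀ hpow key
    rw [ht]
    field_simp
    linear_combination key'
  -- Step D: `β₄` is a unit (else `δ` would not be)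
  have hβ₄ : w (β₄ : v.adicCompletion K) = 1 := by
    refine le_antisymm (hint β₄) ?_
    by_contra hlt
    push Not at hlt
    have h8 : w (8 : v.adicCompletion K) ≤ 1 := by exact_mod_cast hnat 8
    have hA : w (-8 * (β₄ : v.adicCompletion K) ^ 3) < 1 := by
      rw [map_mul, Valuation.map_neg, map_pow]
      calc w 8 * w (β₄ : v.adicCompletion K) ^ 3 ≤ 1 * w (β₄ : v.adicCompletion K) ^ 3 :=
            mul_le_mul' h8 le_rfl
        _ = w (β₄ : v.adicCompletion K) ^ 3 := one_mul _
        _ < 1 := pow_lt_one' hlt (by norm_num)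
    have hB : w (ϖ * (β₆ : v.adicCompletion K) ^ 2) < 1 := by
      refine lt_of_le_of_lt (hdT 1 _ ?_ |>.trans_eq' (by rw [pow_one])) ?_
      · rw [map_pow]; exact pow_le_one' (hint β₆) 2
      · rw [← exp_zero, exp_lt_exp]; norm_num
    have hC : w (ϖ ^ 2 * t) < 1 :=
      lt_of_le_of_lt (hdT 2 t htw) (by rw [← exp_zero, exp_lt_exp]; norm_num)
    have : w (δ : v.adicCompletion K) < 1 := by
      rw [hδeq]
      exact w.map_add_lt (w.map_sub_lt hA hB) hC
    rw [hunit hδ] at this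
    exact lt_irrefl _ this
  exact ⟨hβ₄, t, htw, hδeq⟩

end Local

end Summit.BirchSwinnertonDyer.Rank1Residual.Additive

end
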